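import Literature.MathematicalPhysics.QuantumFieldTheory.Balaban1983to89.B9

/-!
# `Balaban1983to89.B9Carve06Thms31to34Hyp` — [Balaban1985BackgroundPropagators] pp. 397–402 [PDF 9–14] (Sect. A from (3.39) on,
# Theorems 3.1–3.4, Sect. B up to (3.62)): THE HYPOTHESIS-FORM BUNDLE OF CARVING BLOCK 06, with the one clause of Theorem 3.4 the
# tree did not type, and the kernel-checked passage to the consumers' currency `B9.Thms31to33IneqAt`

statement-level skeleton of published theorems with citation tags; proofs where landed; nothing here is a claim about the Yang–Mills mass gap

SOURCE.  T. Bałaban, *Propagators for lattice gauge theories in a background field*, Commun. Math. Phys. **99** (1985) 389–434,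
doi:10.1007/bf01240355 [Balaban1985BackgroundPropagators] (cell paper "B9"; held `paper:balaban1985-cmp99-background-propagators`,
journal page = PDF page + 388).  Pages 396–402 were read first-hand for this file on the page renders
`run/shared/lean/pub/pub-balaban/b2b-balaban-ref1/pages/1985-cmp99-background-propagators/…-p008-x2.png` … `…-p014-x2.png`
(the text layer garbles every display).  STATUS of the source: published, refereed.

WHY THIS FILE (cell `lit-balaban`, P6 CARVING FAN of D-0154 (3b); seat `lit-balaban-carve-06`; block row 06 of
`run/shared/lean/pub/lit-balaban/carve/BLOCKS-01-10.md`, rules `carve/CARVE-RULES.md`; KEY item `stmt-QuantumFields-19200`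
(R3 unit-scale tilt: the [B9] Theorems 3.1–3.3 "at a general regular background" feeding the letters of `B8Thm2TorusLetters.LettersAt`),
also-feeds `stmt-QuantumFields-20542` (K1⁷, lane N06 [B9])).  The block is pp. 397–402 = Theorems 3.1–3.4 with the displays
(3.39)–(3.62).  At statement level this stretch is IN THE TREE (cell SKELETON v3.365: 12 rows, 4 typed-existing, 8 proved) — so, by the
fan's rule «IN TREE = CITE, NEVER RESTATE», this file (a) RESTATES NOTHING: every printed statement of the block that has a declaration
is cited BY NAME below (table), (b) types the ONE printed clause of the block that has no declaration — the `(Q′(U)G′²(U)Q′*(U))⁻¹` and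
`R(U)` half of Theorem 3.4 (`Thm34CinvRPrinted`; `B9.Thm34Printed` carries Theorem 3.4 for `G′` and `G` only), and (c) conjoins the
block's printed THEOREMS, by name, into ONE hypothesis bundle `Hyp` a node prover can take as `(h : Hyp …)`, with the kernel-checked
projections a consumer actually wants: Theorems 3.1, 3.2 separately, the common-threshold form «Theorems 3.1–3.3 hold at every regular
background» in the currency `B9.Thms31to33IneqAt` of `B9.SectBStepPrinted` ∕ `B9.GaugeReduction335` ∕ `B9.Cor36Printed` (hence
Corollary 3.6's typed shape for every cube predicate, the input of `B9Thm310Whole.thm310Printed_of_cor36Printed`), and Theorem 3.4's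
inequality half at `U′U` in the same currency.

## The block's SKELETON rows → the in-tree declarations this file CITES (never restates)

| row | print | in tree (module `…Balaban1983to89.<stem>`) | used here |
|---|---|---|---|
| B9.Thm3.1 | Thm 3.1, (3.42)–(3.47) pp. 397–398 | `B9.Thm31Printed` (+ `B9.Ineq342_346_347`, `B9.Ineq343_345`, `B9.pref4`, `B9.pref6`); joint form with Thm 3.2 «with the same constants»: `B9.Thm31and32Printed` | field `Hyp.thm31_32`; projection `Hyp.thm31` |
| B9.Thm3.2 | Thm 3.2, (3.48) p. 398 | `B9.Thm32Printed`, `B9.Thm31and32Printed`, `B9.thm31_and_thm32_of_joint` | field `Hyp.thm31_32`; projection `Hyp.thm32` |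
| B9.Thm3.3 | Thm 3.3 p. 399 | `B9.Thm33Printed` | field `Hyp.thm33` |
| B9.Thm3.4 | Thm 3.4 p. 400 | `B9.Thm34Printed` (`G′`, `G`); the step behind it `B9.SectBStepPrinted`, `B9.thm34_of_sectB` | field `Hyp.thm34`; the `(Q′G′²Q′*)⁻¹`∕`R` clause NEW here: `Thm34CinvRPrinted`, field `Hyp.thm34_cinvR` |
| B9.Eq3.39 | norms (3.39)–(3.41), cubes Δ(y), Δ̃(y), distance d(y,y′) p. 397 | `B9.Geometry` (`supNorm`, `holder`, `wNorm`, `dist`, `suppIn`∕`suppInT`, `cutIn`∕`cutInT`), `B9.Geometry.len`; concrete: `LatticeNorms`, `B9Eq340HolderZd`, `B9GeoNormsKLevelV1` | carriers of every field |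
| B9.Eq3.49 | (3.49) p. 399 | `B9.FineKernel`, `B9.pref4inv`, `B9.Ineq349`, `B9.Stmt349Printed`; proofs at letters `B9Ineq349*`, `B9Ineq349Hom.ineq349_hom` | field `Hyp.stmt349` |
| B9.Eq3.50 | (3.50)–(3.53) p. 400 | PROVED: `B9Eq352ScalarFluct.siteLap_eq_star`, `….siteLap_prodCfg` ((3.50)), `….Fp1_eq`, `….V1p_eq_firstOrder` ((3.51)–(3.52)), `….eq353` ((3.53)); analyticity of `F′_{1,k}(iad_{A′(b)})`: `B9Eq352Analytic.analyticAt_Fp1` | cited (a theorem is not a hypothesis) |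
| B9.Eq3.54 | (3.54) p. 401 | PROVED: `B9Eq352ScalarFluct.norm_V1p_le`, `….norm_V1p_le_printed` | cited |
| B9.Eq3.55 | (3.55)–(3.57) p. 401 | PROVED: `B7Eq92Concrete.tildIter_eq_mgauge` ((3.56) = [5] (97)), `B9Eq358Decomposition.compT` ((3.55)), `B9Eq357Levels` (the level recursion (3.57), `….qFac_top`, `….norm_pFac_sub_one_le_explicit`) | cited |
| B9.Eq3.58 | (3.58)–(3.59) p. 402 | PROVED: `B9Eq358Decomposition.Fp_eq`, `….conjR_compT_mul`, `….QpC_mul`, `….norm_Fp_le` ((3.58)), `….norm_FpOp_le` ((3.59)); analyticity of `F′_{2,j}`: `B9Eq358Analytic.analyticAt_pFac` | cited |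
| B9.Eq3.60 | (3.60)–(3.61) p. 402 | PROVED: `B9Eq360Vprime.vPrime`, `….eq360`, `….eq360_op`, `….norm_vPrimeOp_le` ((3.61), constants explicit), `….norm_vPrimeFun_V1p_le`; analyticity of `V′(A)`: `B9Eq361VprimeAnalytic.analyticAt_vPrime` | cited |
| B9.Eq3.62 | (3.62) p. 402 | PROVED: `B9Eq360Vprime.eq362`; the Neumann step it opens: `B9Thm34Ext.neumannInverse_majorant` | cited |

## Census of the REMAINING printed sentences of pp. 397–402 (every sentence that asserts something), with disposition
(lines counted on the printed page from the first line below the running head, displays included)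

* p. 397 l. 1–2 «then it satisfies also (3.35), (3.36) with α₀ replaced by O(1)(α₀ + α₁), but we will not use this fact here» (the
  sentence opens on p. 396: «We will prove in another paper that if U′U satisfies the conditions (3.37), (3.38),») — a claim deferred
  to another paper and unused: NOT typed (not a result proved in this source).
* p. 397 after (3.41) «Thus the norm |A|_(α) can be defined as the smallest number C such, that |A(b)| ≦ C(Lʲη)^α for b ∈ Ω_j∖Ω_{j+1},
  j = 0, 1, …, k. For α negative we can take Ω_j instead of Ω_j∖Ω_{j+1} above.» — in tree, PROVED:
  `B9Eq335RegularityClasses.ownLevel_iff_nested_of_antitone` (the «α negative» mechanism), `B9Ineq347SiteReadingY.glob_le_kernelFamilyS`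
  ∕ `B9Ineq347CoReading` («the smallest number C»): cited.
* p. 398 l. 20 «All these inequalities are invariant with respect to gauge transformations of U.» — in tree: quoted in `B9.Thm31Printed`;
  the transfer it licenses is the leaf `B9.GaugeReduction335` and the theorem `B9GaugeReduction335Whole.thms31to33IneqAt_of_invariant`;
  the covariance laws (3.28)–(3.34) are `B9Eq333Cov`: cited.
* p. 398 l. 21–23, remark 1 «the choice of derivatives ∇_U, ∇*_U is conventional, we may always replace ∇_U by ∇*_U, and vice versa, in
  arbitrary place and combination» — a statement about WHICH functionals the kernel family packages: in the abstract currency of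
  `B9.lean` the entries `B9.KernelFamily.e ∕ h1 ∕ e4 ∕ h2 ∕ l2 ∕ glob` are supplied by the model for either placement and the family index
  `I` of every field below ranges over the placements as well (as it ranges over tori, k, {Ω_j}, M), so Theorem 3.1 is asserted for
  each placement with the same constants; the concrete symmetric treatments are `B9SectBL2DictionaryY`, `B9Ineq346L2RightDiff`,
  `B9Thm37AllNormsRight`: ABSORBED by the typing convention (said here), not typed separately.
* p. 398 l. 23–25, remark 2 «Using Lemma 2.1 in [4] we may replace the factor (Lʲη)^α by (Lʲη)^β(L^{j′}η)^γ with β + γ = α» — in tree,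
  PROVED mechanism: `B9Ineq347AllEntries.weight_ratio`, `….rpow_abs_mul_exp_le_one`, `….size_condition_compact` (abstract
  `B9.Geometry`), `B9Ineq347.ScaleTransfer`, `B9Lemma21ShellCrossingZd.rpow_levelGap_le_exp_distZd` (ℤᵈ frame); Lemma 2.1 of [4] itself:
  `B6.Lemma21Printed`, `B6RandomWalk.Ineq260 ∕ Ineq261 ∕ Ineq263`, the family schema `B9Ineq347Reading.Lemma21Above`: cited.
* p. 398 l. 26–27 «the global inequalities (3.47) are consequences of the local ones (3.42) and Lemma 2.1» — in tree, PROVED at the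
  reading level: `B9Ineq347AllEntries.glob347_allEntries`, `B9Ineq347Reading.globBlockOn_of_eBlock`, `….atOneGlobOn_of_atOneEOn`;
  ℤᵈ: `B9Eq347GlobalFromLocalZd.weight_mul_norm_gop_le_of_ineq342` (and its three siblings): cited.
* p. 399 l. 1–3 «the constants in the formulations of both theorems do not depend on the sequence {Ω_j}, j = 0, 1, …, k, if the
  conditions (2.1), (2.2) are satisfied» — ENCODED by the quantifier order of every field (constants BEFORE the family member `i`, which
  carries the torus, `k`, `{Ω_j}`, `M` — `B9.Thm31Printed`'s docstring); member-uniform concrete versions: `B9Thm34SectBUniform`,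
  `B9Thm34AllUniform`: ABSORBED (said in each docstring).
* p. 399 after (3.49) «We have also the corresponding bounds for Hölder norms of the kernel (DPD*)_{μν}(x, x′).» — print displays NO
  formula for them (nor does [4]); the tree records the sentence as not covered (`B9Thm34RFinal`, census G-B9-02): NOT typed — any
  display would be this seat's, not the paper's.
* p. 399 «Thus the operator Δ_a is well defined.» — the existence of (3.26) given (3.49); concrete: `B9Eq333Cov.lapFull` (row B9.Eq3.26),
  `B9Ineq349Whole`, `B9Ineq349FlatTorus`: cited.
* p. 399, the two closing paragraphs of Sect. A (plan of the proofs; differences of operators for two sequences {Ω_j} deferred to Sect. C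
  = Theorem 3.14, `B9.Thm314Printed`): no statement.
* p. 400 «In fact we prove quantitative statements which are more precise, describing these analytic extensions as small perturbations of
  the operators depending on U only.» — the quantitative statements are (3.63)–(3.68), (3.86) pp. 402–407 = carving block 07
  (`B9.SectBStepPrinted`, `B9Thm34Ext`, `B9Thm34Inv`, `B9SectBStepWhole`): boundary, not this block.
* p. 401, the three bounds «(1/i) log Ū′ˡ = Q_l(U, ξA′), |Q_l(U, ξA′)| < 2α₁Lˡξ, |(1/i) log(R̄ Ū′ˡ)| < O(1)α₁L^{l+1}ξ, |v_j(y) − 1| < O(1)α₁»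
  and «|(U′U)(Γ)(U(Γ))⁻¹ − 1| < O(1)α₁» — the first three are (161), (162) of [5] = [Balaban1985Averaging] (not this paper's
  statements; in tree as the printed per-level inputs of `B9Eq357Levels`, HOME census G-B9-p06-1), the fourth is PROVED from them there
  (`B9Eq357Levels.norm_pFac_sub_one_le_explicit`) and outright at j = 1 (`B9Eq358Decomposition.norm_pFac_one_sub_one_le`): cited.
* p. 401 «By Proposition 4 [5] the expression on the right-hand side of (3.57) is an analytic function of A» — `B9Eq358Analytic`: cited.
* p. 402 «The operator F′_{2,j}(A) is an analytic function of A in the domain given by the inequality |A| < α₁(Lʲη)⁻¹» —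
  `B9Eq358Analytic.analyticAt_pFac`: cited.  «We have a similar expansion for the adjoint operator. … Let us remark that F′*_{2,j}(A) is
  not an adjoint of F′_{2,j}(A).» — `B9Eq360Vprime.vPrime` carries `F₂s` as an INDEPENDENT letter for exactly this reason: cited.
  «It [V′(A)] is an analytic function of A on the domain (3.37), for α₁ sufficiently small.» — `B9Eq361VprimeAnalytic.analyticAt_vPrime`:
  cited.  «We assume that Theorem 3.1 is valid for the operator G′(U). The equality (3.60) can be written as (3.62)» —
  `B9Eq360Vprime.eq362`: cited.  ((3.63)–(3.65), printed on the same page, belong to block 07.)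

RESULT OF THE CENSUS: one printed clause of the block without a declaration — Theorem 3.4 for `(Q′(U)G′²(U)Q′*(U))⁻¹` and `R(U)` — typed
below as `Thm34CinvRPrinted`; everything else is cited.

## What is here
* §1 `Thm34CinvRPrinted` — hypothesis-form, in the frame of `B9.Thm34Printed` (same quantifier order, same abstract analyticity
  predicates, the inequality «correspondingly» = (3.48) for the extended `(Q′G′²Q′*)⁻¹` on the class (3.37)).
* §2 `Hyp` — ONE `Prop`-valued structure conjoining BY NAME `B9.Thm31and32Printed`, `B9.Stmt349Printed`, `B9.Thm33Printed`,
  `B9.Thm34Printed`, `Thm34CinvRPrinted`.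
* §3 kernel-checked bookkeeping out of `Hyp` (no new statement asserted): `Hyp.thm31`, `Hyp.thm32` (via `B9.thm31_and_thm32_of_joint`);
  `Hyp.thms31to33IneqAt_of_regular` — ONE threshold pair (M₁, a₀) and ONE constant tuple such that `B9.Thms31to33IneqAt` holds at EVERY
  background of the class (3.35) of every member (Theorem 3.3's tuple for `G′`, `G`; Theorem 3.2's (B₀, δ₀) in the `(Q′G′²Q′*)⁻¹`-slot —
  thresholds merged by max ∕ min, no sign facts of the abstract carriers needed); `Hyp.cor36Printed` — for `c35 > 0` and ANY cube
  predicate `InCube`, `B9.Cor36Printed` (Corollary 3.6's typed shape, with `a₁ := c35·a₀`) — i.e. the bundle feeds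
  `B9Thm310Whole.thm310Printed_of_cor36Printed` ∕ `….local342G_of_cor36Printed` and the M5-modules of the G-B9-LETTERS map that start
  from Corollary 3.6; `Hyp.thm34_ineqAt_of_regular` — Theorem 3.4 for all four operators with ONE `a₁`: the four analytic-extension
  predicates and `B9.Thms31to33IneqAt` at `U′U` on the class (3.37).

## HONEST SCOPE — what is NOT claimed
Nothing of [B9] is proved here and no `…Printed` statement is asserted: `Hyp` is a HYPOTHESIS bundle and `Thm34CinvRPrinted` a
hypothesis-form statement; the §3 theorems are bookkeeping between typed shapes.  The joint witnesses print gives across Theorems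
3.1∕3.2∕3.3 («with the same constants», «with the constants described there») are kept exactly as far as the cited typings keep them
(`B9.Thm31and32Printed` joint; `B9.Thm33Printed` joint in `G′`, `G`; the 3.2↔3.3 coupling is not re-asserted — cell DIVERGENCE D-b09.1,
harmless: max∕min); the ONE printed `a₁` of Theorem 3.4 is witnessed by the min of the two typed thresholds (`Hyp.thm34_ineqAt_of_regular`).
No summit statement is proved by this file; it moves no node count; nothing continuum ∕ ℝ⁴ ∕ OS ∕ mass-gap ∕ Clay.  No `sorry`, no
`instance`, no `notation`, no attribute manipulation; imports `…Balaban1983to89.B9` only.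
-/

namespace Literature.MathematicalPhysics.QuantumFieldTheory.Balaban1983to89.B9Carve06Thms31to34Hyp

variable {I : Type}

/-! ## §1  Theorem 3.4 — the `(Q′(U)G′²(U)Q′*(U))⁻¹` and `R(U)` clauses (the block's one residual printed statement) -/

/-- **Theorem 3.4, the clauses for `(Q′(U)G′²(U)Q′*(U))⁻¹` and `R(U)`** (p. 400 [PDF 12], verbatim): *«Theorem 3.4. There exists a
positive constant a₁ such that the operators G′(U), (Q′(U)G′²(U)Q′*(U))⁻¹, R(U), G(U) extend to configurations U′U for α₁ ≦ a₁ as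
analytic functions of A. The extended operators satisfy all the inequalities of Theorems 3.1–3.3 correspondingly.»*  The in-tree typing
`B9.Thm34Printed` (SKELETON row B9.Thm3.4) carries this for the two kernel FAMILIES `G′` (`Gp`) and `G` (`GA`) — their analytic extension
through an abstract predicate `IsAnalyticExt` and (3.42)–(3.47) on the class (3.37) — and for those two only.  THIS def carries the other
two operators of the printed list, in the same frame and with the same kind of abstract predicates (each supplied by the model, as
`IsAnalyticExt` is): the coarse-lattice kernel `(Q′G′²Q′*)⁻¹` (`Cinv`, carrier `B9.SiteKernel` as in `B9.Thm32Printed`) extends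
analytically (`IsAnalyticExtS i (Cinv i) U α₁` = "`(Q′G′²Q′*)⁻¹(U′U)` is an analytic function of `A` on the domain (3.37) of radius `α₁`
around `U`") and its extension satisfies «correspondingly» THE inequality Theorems 3.1–3.3 state for it, (3.48) of Theorem 3.2, at `U′U`
for every `U′` of the class (3.37) (`B9.Backgrounds.Cplx337`), with constants `B₀, δ₀` independent of the member and of `U`; and `R(U)` —
seen, as everywhere in `B9.lean`, through the fine kernel `P = I − R` of (3.49) (`B9.FineKernel`; p. 403 [PDF 15], the sentence after (3.67): *«These results imply
that the operators R(U), P(U) = I − R(U) extend analytically to the domain (3.37)»*) — extends analytically (`IsAnalyticExtF i (P i) U α₁`).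
Theorems 3.1–3.3 state no inequality for `R` (its bounds are (3.49) p. 399, typed `B9.Stmt349Printed`, and for the extension (3.68)
p. 403 — outside this block), so none is attached to it here.  Quantifier order as in `B9.Thm34Printed`: `a₁, M₁, δ₀, a₀, B₀` BEFORE the
family member `i` and the background `U` (p. 399 l. 1–3: the constants do not depend on `{Ω_j}`); the `a₁` here and the `a₁` of
`B9.Thm34Printed` are two typed witnesses of the ONE printed constant (their min serves both: `Hyp.thm34_ineqAt_of_regular`).
Hypothesis-form; nothing is asserted. [cite: Balaban1985BackgroundPropagators, Thm 3.4 p.400] -/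
def Thm34CinvRPrinted (d : ℕ) (c35 : ℝ) (geo : I → B9.Geometry) (bg : I → B9.Backgrounds)
    (Cinv : ∀ i, B9.SiteKernel (geo i) (bg i)) (P : ∀ i, B9.FineKernel (geo i) (bg i))
    (IsAnalyticExtS : ∀ i, B9.SiteKernel (geo i) (bg i) → (bg i).Cfg → ℝ → Prop)
    (IsAnalyticExtF : ∀ i, B9.FineKernel (geo i) (bg i) → (bg i).Cfg → ℝ → Prop) : Prop :=
  ∃ a₁ M₁ δ₀ a₀ B₀ : ℝ, 0 < a₁ ∧ 0 < M₁ ∧ 0 < δ₀ ∧ 0 < a₀ ∧ 0 < B₀ ∧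
    ∀ i : I, M₁ ≤ (geo i).M → ∀ α₀ α₁ : ℝ, 0 < α₀ → (geo i).M * α₀ ≤ a₀ → 0 < α₁ → α₁ ≤ a₁ →
      ∀ U : (bg i).Cfg, (bg i).Reg335 c35 α₀ U →
        IsAnalyticExtS i (Cinv i) U α₁ ∧ IsAnalyticExtF i (P i) U α₁ ∧
        ∀ U' : (bg i).Cfg, (bg i).Cplx337 α₁ U U' →
          ∀ y y' : (geo i).Site, |(Cinv i).ker ((bg i).mul U' U) y y'| ≤
            B₀ * ((geo i).len y) ^ (-(4 : ℝ)) * ((geo i).len y') ^ (-(d : ℝ)) *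
              Real.exp (-(δ₀ * (geo i).dist y y'))

/-! ## §2  The bundle of block 06: Theorems 3.1–3.4 and (3.49), by name -/

/-- **BLOCK 06 HYPOTHESIS BUNDLE — [B9] Sects. A–B pp. 397–400: Theorems 3.1, 3.2, the claim (3.49), Theorem 3.3, Theorem 3.4, each the
in-tree typed statement BY NAME** (for one family `I` of models — member `i` = (torus, `k`, the sequence `{Ω_j}` subject to (2.1)–(2.2)
of [4], `M`, and the placement of `∇_U` ∕ `∇*_U` in the packaged functionals, p. 398 remark 1), its geometries `geo`, backgrounds `bg`
(with the class (3.35) `Reg335 c35` and the complex class (3.37) `Cplx337`), the kernel families `Gp = G′`, `GA = G`, the coarse kernel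
`Cinv = (Q′G′²Q′*)⁻¹`, the fine kernel `P = I − R`, and the model's analyticity predicates for the three carriers).  Fields:
`thm31_32` = Theorems 3.1 + 3.2 «with the same constants» (pp. 397–398; `B9.Thm31and32Printed`); `stmt349` = (3.49) for `P = I − R`
under the assumptions of Theorem 3.1 (p. 399; `B9.Stmt349Printed`); `thm33` = Theorem 3.3 (p. 399; `B9.Thm33Printed`, which carries
Theorem 3.1's block for `G′` next to the one for `G` «with the constants described there»); `thm34` = Theorem 3.4 for `G′`, `G` (p. 400;
`B9.Thm34Printed`); `thm34_cinvR` = Theorem 3.4 for `(Q′G′²Q′*)⁻¹`, `R` (p. 400; `Thm34CinvRPrinted` of §1).  The PROVED rows of the block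
((3.50)–(3.62), module docstring table) are theorems of the tree and therefore not hypotheses.  A consumer takes `(h : Hyp …)` and
uses §3. [cite: Balaban1985BackgroundPropagators, Thms 3.1–3.4 + (3.49) pp.397–400] -/
structure Hyp (d : ℕ) (c35 : ℝ) (geo : I → B9.Geometry) (bg : I → B9.Backgrounds)
    (Gp GA : ∀ i, B9.KernelFamily (geo i) (bg i)) (Cinv : ∀ i, B9.SiteKernel (geo i) (bg i))
    (P : ∀ i, B9.FineKernel (geo i) (bg i))
    (IsAnalyticExt : ∀ i, B9.KernelFamily (geo i) (bg i) → (bg i).Cfg → ℝ → Prop)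
    (IsAnalyticExtS : ∀ i, B9.SiteKernel (geo i) (bg i) → (bg i).Cfg → ℝ → Prop)
    (IsAnalyticExtF : ∀ i, B9.FineKernel (geo i) (bg i) → (bg i).Cfg → ℝ → Prop) : Prop where
  /-- **Theorems 3.1 and 3.2** (pp. 397–398 [PDF 9–10]) jointly, «with the same constants» — `B9.Thm31and32Printed`.
  [cite: Balaban1985BackgroundPropagators, Thm 3.1 + Thm 3.2 (3.42)–(3.48) pp.397–398] -/
  thm31_32 : B9.Thm31and32Printed d c35 geo bg Gp Cinv
  /-- **(3.49)** (p. 399 [PDF 11]) for `P = I − R` — `B9.Stmt349Printed`. [cite: Balaban1985BackgroundPropagators, (3.49) p.399] -/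
  stmt349 : B9.Stmt349Printed d c35 geo bg P
  /-- **Theorem 3.3** (p. 399 [PDF 11]) — `B9.Thm33Printed`. [cite: Balaban1985BackgroundPropagators, Thm 3.3 p.399] -/
  thm33 : B9.Thm33Printed c35 geo bg Gp GA
  /-- **Theorem 3.4** (p. 400 [PDF 12]) for `G′`, `G` — `B9.Thm34Printed`. [cite: Balaban1985BackgroundPropagators, Thm 3.4 p.400] -/
  thm34 : B9.Thm34Printed c35 geo bg Gp GA IsAnalyticExt
  /-- **Theorem 3.4** (p. 400 [PDF 12]) for `(Q′G′²Q′*)⁻¹`, `R` — `Thm34CinvRPrinted` (§1). [cite: Balaban1985BackgroundPropagators, Thm 3.4 p.400] -/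
  thm34_cinvR : Thm34CinvRPrinted d c35 geo bg Cinv P IsAnalyticExtS IsAnalyticExtF

/-! ## §3  Kernel-checked bookkeeping out of the bundle (no statement asserted) -/

namespace Hyp

variable {d : ℕ} {c35 : ℝ} {geo : I → B9.Geometry} {bg : I → B9.Backgrounds}
  {Gp GA : ∀ i, B9.KernelFamily (geo i) (bg i)} {Cinv : ∀ i, B9.SiteKernel (geo i) (bg i)}
  {P : ∀ i, B9.FineKernel (geo i) (bg i)}
  {IsAnalyticExt : ∀ i, B9.KernelFamily (geo i) (bg i) → (bg i).Cfg → ℝ → Prop}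
  {IsAnalyticExtS : ∀ i, B9.SiteKernel (geo i) (bg i) → (bg i).Cfg → ℝ → Prop}
  {IsAnalyticExtF : ∀ i, B9.FineKernel (geo i) (bg i) → (bg i).Cfg → ℝ → Prop}

/-- **Theorem 3.1 alone** out of the bundle (row B9.Thm3.1's typed statement `B9.Thm31Printed`), by `B9.thm31_and_thm32_of_joint`.
[cite: Balaban1985BackgroundPropagators, Thm 3.1 pp.397–398 (bookkeeping)] -/
theorem thm31 (h : Hyp d c35 geo bg Gp GA Cinv P IsAnalyticExt IsAnalyticExtS IsAnalyticExtF) :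
    B9.Thm31Printed c35 geo bg Gp :=
  (B9.thm31_and_thm32_of_joint d c35 geo bg Gp Cinv h.thm31_32).1

/-- **Theorem 3.2 alone** out of the bundle (row B9.Thm3.2's typed statement `B9.Thm32Printed`), by `B9.thm31_and_thm32_of_joint`.
[cite: Balaban1985BackgroundPropagators, Thm 3.2 (3.48) p.398 (bookkeeping)] -/
theorem thm32 (h : Hyp d c35 geo bg Gp GA Cinv P IsAnalyticExt IsAnalyticExtS IsAnalyticExtF) :
    B9.Thm32Printed d c35 geo bg Cinv :=
  (B9.thm31_and_thm32_of_joint d c35 geo bg Gp Cinv h.thm31_32).2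

/-- **«Theorems 3.1–3.3 hold at every background of the class (3.35)» in the consumers' currency** — the form the Sect. B step
(`B9.SectBStepPrinted`), the gauge reduction (`B9.GaugeReduction335`) and Corollary 3.6 (`B9.Cor36Printed`) read: ONE threshold pair
(M₁, a₀) and ONE constant tuple (B₀, δ₀, B₀(·), B′₀(·), B′₀(·,·), B₁, δ₁) such that for every member with `M ≥ M₁`, every `α₀ > 0`
with `Mα₀ ≤ a₀` and every `U` satisfying (3.35), `B9.Thms31to33IneqAt d (G′) (G) ((Q′G′²Q′*)⁻¹) … U`.  From `thm31_32` (its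
(B₀, δ₀) go to the `(Q′G′²Q′*)⁻¹`-slot (B₁, δ₁) — print: «with the same constants») and `thm33` (its tuple serves `G′` and `G` —
print: «with the constants described there»); thresholds merged by `max` ∕ `min`; no sign facts of the abstract carriers are used.
[cite: Balaban1985BackgroundPropagators, Thms 3.1–3.3 pp.397–399 (bookkeeping)] -/
theorem thms31to33IneqAt_of_regular (h : Hyp d c35 geo bg Gp GA Cinv P IsAnalyticExt IsAnalyticExtS IsAnalyticExtF) :
    ∃ M₁ a₀ B₀ δ₀ : ℝ, ∃ Bβ Bε : ℝ → ℝ, ∃ Bεβ : ℝ → ℝ → ℝ, ∃ B₁ δ₁ : ℝ,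
      0 < M₁ ∧ 0 < a₀ ∧ 0 < B₀ ∧ 0 < δ₀ ∧ 0 < B₁ ∧ 0 < δ₁ ∧
      ∀ i : I, M₁ ≤ (geo i).M → ∀ α₀ : ℝ, 0 < α₀ → (geo i).M * α₀ ≤ a₀ →
        ∀ U : (bg i).Cfg, (bg i).Reg335 c35 α₀ U →
          B9.Thms31to33IneqAt d (Gp i) (GA i) (Cinv i) B₀ δ₀ Bβ Bε Bεβ B₁ δ₁ U := by
  obtain ⟨M₂, δ₂, a₂, B₂, Bβ₂, Bε₂, Bεβ₂, hM₂, hδ₂, ha₂, hB₂, H₂⟩ := h.thm31_32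
  obtain ⟨M₃, δ₃, a₃, B₃, Bβ₃, Bε₃, Bεβ₃, hM₃, hδ₃, ha₃, hB₃, H₃⟩ := h.thm33
  refine ⟨max M₂ M₃, min a₂ a₃, B₃, δ₃, Bβ₃, Bε₃, Bεβ₃, B₂, δ₂, lt_max_of_lt_left hM₂, lt_min ha₂ ha₃, hB₃, hδ₃, hB₂, hδ₂, ?_⟩
  intro i hMi α₀ hα hMa U hU
  have h2 := H₂ i (le_trans (le_max_left _ _) hMi) α₀ hα (le_trans hMa (min_le_left _ _)) U hU
  have h3 := H₃ i (le_trans (le_max_right _ _) hMi) α₀ hα (le_trans hMa (min_le_right _ _)) U hU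
  exact ⟨h3.1, h2.2.2, h3.2⟩

/-- **Corollary 3.6's typed shape out of the bundle** — for `c35 > 0` (the O(1) of (3.35)) and ANY cube predicate `InCube`,
`B9.Cor36Printed d c35 geo bg InCube G′ G (Q′G′²Q′*)⁻¹` holds with `a₁ := c35·a₀`: Corollary 3.6 (p. 408, *«If a configuration U
satisfies (3.35) with O(1)Mα₀ ≦ a₁, and Ω′₀ ⊂ □ …, then Theorems 3.1–3.3 hold for the operators G′(U), (Q′(U)G′²(U)Q′*(U))⁻¹, G(U)»*) is,
as typed, a special case of «Theorems 3.1–3.3 at every background of the class (3.35)» (`thms31to33IneqAt_of_regular`) — the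
bundle thus feeds `B9Thm310Whole.thm310Printed_of_cor36Printed` ∕ `….local342G_of_cor36Printed` and every module that starts from
Corollary 3.6.  (The paper's own route is the converse one: Cor. 3.6 for the local operators first, Theorems 3.1–3.3 by the random walk
expansions of Sect. C — `B9.sectsAC_architecture`; nothing of that is touched.) [cite: Balaban1985BackgroundPropagators, Cor. 3.6 p.408 + Thms 3.1–3.3 pp.397–399 (bookkeeping)] -/
theorem cor36Printed (h : Hyp d c35 geo bg Gp GA Cinv P IsAnalyticExt IsAnalyticExtS IsAnalyticExtF) (hc : 0 < c35)
    (InCube : I → Prop) : B9.Cor36Printed d c35 geo bg InCube Gp GA Cinv := by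
  obtain ⟨M₁, a₀, B₀, δ₀, Bβ, Bε, Bεβ, B₁, δ₁, hM, ha, hB, hδ, hB₁, hδ₁, H⟩ := h.thms31to33IneqAt_of_regular
  refine ⟨c35 * a₀, M₁, B₀, δ₀, Bβ, Bε, Bεβ, B₁, δ₁, mul_pos hc ha, hM, hB, hδ, hB₁, hδ₁, ?_⟩
  intro i _ hMi α₀ hα hsmall U hU
  refine H i hMi α₀ hα ?_ U hU
  have h' : c35 * ((geo i).M * α₀) ≤ c35 * a₀ := by rw [← mul_assoc]; exact hsmall
  exact le_of_mul_le_mul_left h' hc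

/-- **Theorem 3.4 for all four operators with ONE `a₁`, inequality half in the consumers' currency** — out of `thm34` (`G′`, `G`)
and `thm34_cinvR` (`(Q′G′²Q′*)⁻¹`, `R`): one `a₁` (the min of the two typed witnesses — print has one), one threshold pair (M₁, a₀) and one
constant tuple such that for every member with `M ≥ M₁`, every `α₀ > 0` with `Mα₀ ≤ a₀`, every `0 < α₁ ≤ a₁` and every `U` of the
class (3.35): the four operators extend analytically with radius `α₁` (the model's predicates), and at every `U′U`, `U′` in the
class (3.37), `B9.Thms31to33IneqAt d (G′) (G) ((Q′G′²Q′*)⁻¹) … (U′U)` — *«The extended operators satisfy all the inequalities of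
Theorems 3.1–3.3 correspondingly»*.  This is the SHAPE of the conclusion of `B9.SectBStepPrinted` (there conditional on Theorems
3.1–3.3 at `U`; here from Theorem 3.4 as typed). [cite: Balaban1985BackgroundPropagators, Thm 3.4 p.400 (bookkeeping)] -/
theorem thm34_ineqAt_of_regular (h : Hyp d c35 geo bg Gp GA Cinv P IsAnalyticExt IsAnalyticExtS IsAnalyticExtF) :
    ∃ a₁ M₁ a₀ B₀ δ₀ : ℝ, ∃ Bβ Bε : ℝ → ℝ, ∃ Bεβ : ℝ → ℝ → ℝ, ∃ B₁ δ₁ : ℝ,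
      0 < a₁ ∧ 0 < M₁ ∧ 0 < a₀ ∧ 0 < B₀ ∧ 0 < δ₀ ∧ 0 < B₁ ∧ 0 < δ₁ ∧
      ∀ i : I, M₁ ≤ (geo i).M → ∀ α₀ α₁ : ℝ, 0 < α₀ → (geo i).M * α₀ ≤ a₀ → 0 < α₁ → α₁ ≤ a₁ →
        ∀ U : (bg i).Cfg, (bg i).Reg335 c35 α₀ U →
          (IsAnalyticExt i (Gp i) U α₁ ∧ IsAnalyticExt i (GA i) U α₁ ∧
            IsAnalyticExtS i (Cinv i) U α₁ ∧ IsAnalyticExtF i (P i) U α₁) ∧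
          ∀ U' : (bg i).Cfg, (bg i).Cplx337 α₁ U U' →
            B9.Thms31to33IneqAt d (Gp i) (GA i) (Cinv i) B₀ δ₀ Bβ Bε Bεβ B₁ δ₁ ((bg i).mul U' U) := by
  obtain ⟨a₁, M₁, δ₀, a₀, B₀, Bβ, Bε, Bεβ, ha₁, hM₁, hδ₀, ha₀, hB₀, H⟩ := h.thm34
  obtain ⟨a₁', M₁', δ₀', a₀', B₀', ha₁', hM₁', hδ₀', ha₀', hB₀', H'⟩ := h.thm34_cinvR
  refine ⟨min a₁ a₁', max M₁ M₁', min a₀ a₀', B₀, δ₀, Bβ, Bε, Bεβ, B₀', δ₀', lt_min ha₁ ha₁', lt_max_of_lt_left hM₁,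
    lt_min ha₀ ha₀', hB₀, hδ₀, hB₀', hδ₀', ?_⟩
  intro i hMi α₀ α₁ hα₀ hMa hα₁ hα₁a U hU
  obtain ⟨hA₁, hA₂, hext⟩ := H i (le_trans (le_max_left _ _) hMi) α₀ α₁ hα₀ (le_trans hMa (min_le_left _ _)) hα₁
    (le_trans hα₁a (min_le_left _ _)) U hU
  obtain ⟨hA₃, hA₄, hext'⟩ := H' i (le_trans (le_max_right _ _) hMi) α₀ α₁ hα₀ (le_trans hMa (min_le_right _ _)) hα₁
    (le_trans hα₁a (min_le_right _ _)) U hU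
  refine ⟨⟨hA₁, hA₂, hA₃, hA₄⟩, fun U' hU' => ?_⟩
  obtain ⟨h₁, h₂, h₃, h₄⟩ := hext U' hU'
  exact ⟨⟨h₁, h₂⟩, hext' U' hU', h₃, h₄⟩

end Hyp

end Literature.MathematicalPhysics.QuantumFieldTheory.Balaban1983to89.B9Carve06Thms31to34Hyp
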